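import Mathlib
import Summits.ValiantsHypothesis.ValiantsHypothesis.Theorems.DivisionGapPerMultiplesHardRelDenseHostAux

/-!
# `DivisionGap.PerMultiplesHard` (stmt-ValiantsHypothesis-5068), line `uncharged-face-walk`:
stub `stub_fibLeRelaxed` — the Brégman-fibre estimate `fib_le` with the relaxed window `n ≤ 20 u`

The relative dense-host jaw bounds a block-diagonal fibre of `PM(Y)` by Brégman–Minc,
`#Fib ≤ ∏_j (D_j !)^{1/D_j}`, and then needs the analytic estimate

  `∏_j (D_j !)^{1/D_j} ≤ β^n · u! · (n-u)! · exp (30 ε n/β + (log n + 16)/β)`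

whenever all `D_j ≥ 1`, `Σ_{j ∈ T} D_j ≤ β u² + ε n²`, `Σ_{j ∉ T} D_j ≤ β (n-u)² + ε n²`
(`u = #T`, `0 < β ≤ 1`, `0 ≤ ε ≤ 1`).  The strict version
`RelDenseHostAux.fib_le` assumes the window `n < 10 u`, `5 u ≤ 4 n`; the line's hybrid-probe
engine only guarantees `n ≤ 10 u + 10`, i.e. `n ≤ 20 u` once `n ≥ 20`.  This file re-runs the
bookkeeping of `RelDenseHostAux` for that window:

* `part_le20` is `RelDenseHostAux.part_le` with the slope constant `K ≤ 20` instead of `K ≤ 10`: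
  Jensen (`RelDenseHostAux.jensen_finset`) at the level `D := max (e/v + 1) ⌈β v⌉₊`, now with
  `D ≤ β v + 20 n + 1 ≤ 32 n = 16 · (2 n)`, so the Stirling level estimate
  `RelDenseHostAux.gamma_level_bound` is invoked with `2 n` in place of `n`, and
  `log (2 n) = log 2 + log n ≤ log n + 1` costs one extra `1/β`
  (per part: `v log β + log (v !) + K ε n/β + (log n)/(2β) + 5/β`);
* `stub_fibLeRelaxed` splits `Σ_j log (D_j !)/D_j` over `T` (`part_le20`, `K = 20`) and `Tᶜ`
  (`RelDenseHostAux.part_le`, `K = 5`, as `n ≤ 5 (n - u)`), giving the exponent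
  `25 ε n/β + (log n + 9)/β ≤ 30 ε n/β + (log n + 16)/β`.
-/

noncomputable section

-- `Summit.ValiantsHypothesis.ValiantsHypothesis.…` is the tree's mandated layout (Sub = Summit).
set_option linter.dupNamespace false

namespace Summit.ValiantsHypothesis.ValiantsHypothesis.Theorems.DivisionGap.PerMultiplesHard.FibLeRelaxed

open Finset
open scoped BigOperators

/-- **One part of the exponent, relaxed window.**  For a column set `s` (`#s = v ≥ 1`,
`n ≤ K v`, `K ≤ 20`) and degrees `d_j ≥ 1` on `s` with `Σ_{j ∈ s} d_j ≤ β v² + ε n²`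
(`0 < β ≤ 1`, `0 ≤ ε ≤ 1`):
`Σ_{j ∈ s} log (d_j !)/d_j ≤ v log β + log (v !) + K ε n/β + (log n)/(2β) + 5/β`.
Jensen (`RelDenseHostAux.jensen_finset`) at the level `D := max (e/v + 1) ⌈β v⌉₊`
(`e := Σ d_j ≤ v D`, `β v ≤ D ≤ β v + ε n²/v + 1 ≤ 32 n = 16 (2 n)`), then
`RelDenseHostAux.gamma_level_bound` at `2 n` with `c := ε n²/v ≤ K ε n`, and
`log (2 n) ≤ log n + 1`.  (Adapted from `RelDenseHostAux.part_le`, which has `K ≤ 10`.)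
[folklore] -/
theorem part_le20 {n : ℕ} (s : Finset (Fin n)) (d : Fin n → ℕ) (β ε K : ℝ) (hβ : 0 < β)
    (hβ1 : β ≤ 1) (hε : 0 ≤ ε) (hε1 : ε ≤ 1) (hK : K ≤ 20) (hn : 1 ≤ n) (hs : 1 ≤ s.card)
    (hKs : (n : ℝ) ≤ K * s.card) (hd : ∀ j ∈ s, 1 ≤ d j)
    (he : ((∑ j ∈ s, d j : ℕ) : ℝ) ≤ β * s.card * s.card + ε * (n : ℝ) ^ 2) :
    ∑ j ∈ s, Real.log ((d j).factorial : ℝ) / (d j : ℝ) ≤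
      (s.card : ℝ) * Real.log β + Real.log (s.card.factorial : ℝ) + K * ε * n / β +
        Real.log n / (2 * β) + 5 / β := by
  -- the level `D`
  obtain ⟨v, hv⟩ : ∃ v : ℕ, v = s.card := ⟨_, rfl⟩
  obtain ⟨e, he_def⟩ : ∃ e : ℕ, e = ∑ j ∈ s, d j := ⟨_, rfl⟩
  obtain ⟨D, hD⟩ : ∃ D : ℕ, D = max (e / v + 1) ⌈β * v⌉₊ := ⟨_, rfl⟩
  rw [← hv] at hs hKs he ⊢
  rw [← he_def] at he
  have hv0 : 0 < v := hs
  have hvR : (0 : ℝ) < v := by exact_mod_cast hv0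
  have hnR : (0 : ℝ) < n := by exact_mod_cast hn
  have hD1 : 1 ≤ D := by rw [hD]; exact le_max_of_le_left (Nat.le_add_left 1 _)
  -- `Σ d ≤ v · D`
  have hsum : ∑ j ∈ s, d j ≤ s.card * D := by
    rw [← he_def, ← hv]
    have h1 : e < e / v * v + v := Nat.lt_div_mul_add hv0
    have h2 : e / v * v + v = v * (e / v + 1) := by ring
    have h3 : v * (e / v + 1) ≤ v * D :=
      Nat.mul_le_mul_left _ (by rw [hD]; exact le_max_left _ _)
    omega
  -- Jensen
  have hJ := RelDenseHostAux.jensen_finset s d D hD1 hd hsum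
  rw [← hv] at hJ
  -- bounds on `D` over `ℝ`
  have hlo : β * v ≤ D := by
    calc β * v ≤ (⌈β * v⌉₊ : ℝ) := Nat.le_ceil _
      _ ≤ D := by rw [hD]; exact_mod_cast le_max_right _ _
  have hev : (e : ℝ) ≤ (β * v + ε * (n : ℝ) ^ 2 / v) * v := by
    have : (β * v + ε * (n : ℝ) ^ 2 / v) * v = β * v * v + ε * (n : ℝ) ^ 2 := by
      field_simp
    rw [this]
    exact he
  have hhi : (D : ℝ) ≤ β * v + ε * (n : ℝ) ^ 2 / v + 1 := by
    have h1 : ((e / v : ℕ) : ℝ) ≤ (e : ℝ) / v := Nat.cast_div_le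
    have h2 : (e : ℝ) / v ≤ β * v + ε * (n : ℝ) ^ 2 / v := by rwa [div_le_iff₀ hvR]
    have h3 : (⌈β * v⌉₊ : ℝ) < β * v + 1 := Nat.ceil_lt_add_one (by positivity)
    have h4 : 0 ≤ ε * (n : ℝ) ^ 2 / v := by positivity
    rw [hD, Nat.cast_max, Nat.cast_add, Nat.cast_one]
    exact max_le (by linarith) (by linarith)
  have hvn : v ≤ n := by
    have := s.card_le_univ
    rwa [Fintype.card_fin, ← hv] at this
  have hvnR : (v : ℝ) ≤ n := by exact_mod_cast hvn
  have hK0 : 0 ≤ K := by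
    by_contra hK0
    have : K * v < 0 := mul_neg_of_neg_of_pos (not_le.mp hK0) hvR
    linarith
  have hcK : ε * (n : ℝ) ^ 2 / v ≤ K * ε * n := by
    rw [div_le_iff₀ hvR]
    have h1 : (n : ℝ) ^ 2 ≤ K * v * n := by nlinarith
    calc ε * (n : ℝ) ^ 2 ≤ ε * (K * v * n) := mul_le_mul_of_nonneg_left h1 hε
      _ = K * ε * n * v := by ring
  have hc20 : ε * (n : ℝ) ^ 2 / v ≤ 20 * n := by
    have h1 : K * ε ≤ 20 := by
      have := mul_le_mul_of_nonneg_left hε1 hK0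
      linarith [mul_one K]
    calc ε * (n : ℝ) ^ 2 / v ≤ K * ε * n := hcK
      _ ≤ 20 * n := mul_le_mul_of_nonneg_right h1 hnR.le
  -- the level is at most `32 n = 16 · (2 n)`
  have h32 : (D : ℝ) ≤ 16 * ((2 * n : ℕ) : ℝ) := by
    have h1 : β * v ≤ v := mul_le_of_le_one_left hvR.le hβ1
    have hn1 : (1 : ℝ) ≤ n := by exact_mod_cast hn
    push_cast
    linarith
  have hmain := RelDenseHostAux.gamma_level_bound β (ε * (n : ℝ) ^ 2 / v) (2 * n) v D hβ hs
    (by omega) hD1 hlo hhi h32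
  have hcβ : ε * (n : ℝ) ^ 2 / v / β ≤ K * ε * n / β :=
    (div_le_div_iff_of_pos_right hβ).mpr hcK
  -- `log (2 n) ≤ log n + 1`, at the price of one more `1/β`
  have hlog2n : Real.log ((2 * n : ℕ) : ℝ) / (2 * β) ≤ Real.log n / (2 * β) + 1 / β := by
    have hlog2 : Real.log 2 ≤ 1 := by
      have := Real.log_le_sub_one_of_pos (show (0 : ℝ) < 2 by norm_num)
      linarith
    have e1 : Real.log ((2 * n : ℕ) : ℝ) = Real.log 2 + Real.log n := by
      push_cast
      exact Real.log_mul (by norm_num) hnR.ne'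
    rw [e1, add_div]
    have h2 : Real.log 2 / (2 * β) ≤ 1 / β := by
      rw [div_le_div_iff₀ (by positivity) hβ]
      nlinarith
    linarith
  have e5 : (5 : ℝ) / β = 1 / β + 4 / β := by ring
  rw [e5]
  linarith

/-- **stub_fibLeRelaxed — the fibre bound with the relaxed window.**  If
`X ≤ ∏_j (r_j !)^{1/r_j}` with all `r_j ≥ 1`, `Σ_{j ∈ T} r_j ≤ β u² + ε n²`,
`Σ_{j ∉ T} r_j ≤ β (n-u)² + ε n²` (`u := #T`, `20 ≤ n ≤ 20 u`, `5 u ≤ 4 n`, `0 < β ≤ 1`,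
`0 ≤ ε ≤ 1`), then `X ≤ β^n · u! · (n-u)! · exp (30 ε n/β + (log n + 16)/β)`: write the product
as `exp (Σ_j log (r_j !)/r_j)` (`BregmanFibre.factorial_rpow_eq_exp`), split the sum over `T` and
`Tᶜ` and apply `part_le20` with `K = 20` resp. `RelDenseHostAux.part_le` with `K = 5`; the two
parts add up to `25 ε n/β + (log n + 9)/β`, below the claim.  (Adapted from
`RelDenseHostAux.fib_le`, the strict window `n < 10 u`.) [folklore] -/
theorem stub_fibLeRelaxed :
    ∀ {n : ℕ} (T : Finset (Fin n)) (β ε X : ℝ) (r : Fin n → ℕ),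
      0 < β → β ≤ 1 → 0 ≤ ε → ε ≤ 1 →
      X ≤ ∏ j, (((r j).factorial : ℕ) : ℝ) ^ ((1 : ℝ) / (r j : ℝ)) →
      (∀ j, 1 ≤ r j) →
      ((∑ j ∈ T, r j : ℕ) : ℝ) ≤ β * T.card * T.card + ε * (n : ℝ) ^ 2 →
      ((∑ j ∈ Tᶜ, r j : ℕ) : ℝ) ≤ β * Tᶜ.card * Tᶜ.card + ε * (n : ℝ) ^ 2 →
      20 ≤ n → n ≤ 20 * T.card → 5 * T.card ≤ 4 * n →
      X ≤ β ^ n * ((T.card.factorial : ℝ) * ((n - T.card).factorial : ℝ)) *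
        Real.exp (30 * ε * n / β + (Real.log n + 16) / β) := by
  intro n T β ε X r hβ hβ1 hε hε1 hX hr hT hTc h20n h20 h5
  have hun : T.card ≤ n := by
    have := T.card_le_univ
    rwa [Fintype.card_fin] at this
  have hu1 : 1 ≤ T.card := by omega
  have hn1 : 1 ≤ n := by omega
  have hTcc : Tᶜ.card = n - T.card := by rw [Finset.card_compl, Fintype.card_fin]
  have hnu1 : 1 ≤ Tᶜ.card := by rw [hTcc]; omega
  -- the product as an exponential
  rw [Finset.prod_congr rfl fun j _ => BregmanFibre.factorial_rpow_eq_exp (r j),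
    ← Real.exp_sum] at hX
  -- the two parts
  have h20R : (n : ℝ) ≤ 20 * (T.card : ℝ) := by exact_mod_cast h20
  have hA := part_le20 T r β ε 20 hβ hβ1 hε hε1 le_rfl hn1 hu1 h20R (fun j _ => hr j) hT
  have hcast : ((Tᶜ.card : ℕ) : ℝ) = n - T.card := by rw [hTcc, Nat.cast_sub hun]
  have h5R : (n : ℝ) ≤ 5 * (Tᶜ.card : ℝ) := by
    rw [hcast]
    have : ((5 * T.card : ℕ) : ℝ) ≤ ((4 * n : ℕ) : ℝ) := by exact_mod_cast h5
    push_cast at this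
    linarith
  have hB := RelDenseHostAux.part_le Tᶜ r β ε 5 hβ hβ1 hε hε1 (by norm_num) hn1 hnu1 h5R
    (fun j _ => hr j) hTc
  rw [hTcc] at hB
  rw [hTcc] at hcast
  rw [hcast] at hB
  -- combine
  have hsplit := Finset.sum_add_sum_compl T
    (fun j => Real.log (((r j).factorial : ℕ) : ℝ) / (r j : ℝ))
  have e2 : (n : ℝ) * Real.log β =
      (T.card : ℝ) * Real.log β + ((n : ℝ) - T.card) * Real.log β := by ring
  have h7 : 0 ≤ 7 / β := by positivity
  have h5ε : 0 ≤ 5 * ε * n / β := by positivity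
  have htot : ∑ j, Real.log (((r j).factorial : ℕ) : ℝ) / (r j : ℝ) ≤
      Real.log (β ^ n) + Real.log (T.card.factorial : ℝ) +
        Real.log ((n - T.card).factorial : ℝ) +
        (30 * ε * n / β + (Real.log n + 16) / β) := by
    rw [← hsplit, Real.log_pow]
    have e1 : 30 * ε * n / β + (Real.log n + 16) / β =
        20 * ε * n / β + 5 * ε * n / β + 5 * ε * n / β + Real.log n / (2 * β) +
          Real.log n / (2 * β) + 5 / β + 4 / β + 7 / β := by
      field_simp
      ring
    rw [e1]
    linarith
  have hf1 : (0 : ℝ) < (T.card.factorial : ℝ) := by exact_mod_cast Nat.factorial_pos _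
  have hf2 : (0 : ℝ) < ((n - T.card).factorial : ℝ) := by exact_mod_cast Nat.factorial_pos _
  calc X ≤ _ := hX
    _ ≤ Real.exp (Real.log (β ^ n) + Real.log (T.card.factorial : ℝ) +
          Real.log ((n - T.card).factorial : ℝ) +
          (30 * ε * n / β + (Real.log n + 16) / β)) := Real.exp_le_exp.mpr htot
    _ = β ^ n * ((T.card.factorial : ℝ) * ((n - T.card).factorial : ℝ)) *
          Real.exp (30 * ε * n / β + (Real.log n + 16) / β) := by
        rw [Real.exp_add, Real.exp_add, Real.exp_add, Real.exp_log (pow_pos hβ n),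
          Real.exp_log hf1, Real.exp_log hf2]
        ring

end Summit.ValiantsHypothesis.ValiantsHypothesis.Theorems.DivisionGap.PerMultiplesHard.FibLeRelaxed

end
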